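import Mathlib
import Literature.Analysis.FluidPDE.NSWave0
import Literature.Analysis.FluidPDE.ClassicalSolution
import Literature.Claims.NS.ClayVariants
import HarnessLib

/-!
# Claim skeleton (D-0090 NS-CLAIMS): Dongsheng Li, "Existence of Smooth Solutions of the Navier–Stokes
Equations", arXiv:1308.3909 **v1** (19 Aug 2013; the only version), 45 pp.
[claim: Li2013, status: disputed]

This file TYPES the paper's claimed theorem and the steps of its printed proof as `Prop`-valued
definitions. NOTHING HERE IS ASSERTED: no axiom, no `sorry`; every displayed statement is the AUTHOR'S
CLAIM. The verdict (refuter / referee seats) is recorded in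
`run/shared/lean/pub/ns-claims/WHERE-PROOFS-BREAK.md`, never in this file.

WHAT THIS IS NOT: not a claim about NS regularity or blow-up; not a claim about any author beyond the
typed locator.

## The paper's architecture (TeX line numbers of `v1-2013-08-19-FNL-NSE.tex`; p. = PDF page) and the
## ORDERED STEP INDEX

The paper designs the series (5.1) `𝒮_B(u)(t) = Σ_{k ≥ k₀} Σ_{j ≥ j₀} ‖D^σ P_j u(t)‖_k^k / 2^{B_k}`,
`B_k = (B + 1 + 1/√k) k`, `σ = 2`, `j₀ = 1`, `k₀ = 100` (p. 17), over its own Littlewood–Paley projections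
`P_j` (§2, p. 4). The `P_j` and the series are NOT constructed here: Steps 2–5 are typed over an ABSTRACT
series functional `𝒮 : ℝ → (ℝ → ℝ³ → ℝ³) → ℝ → ℝ≥0∞`, `(B, u, t) ↦ 𝒮_B(u)(t)` (the statements' shape
and locators, for the map); the LOAD-BEARING a priori estimate Corollary 8.2 (p. 42), the classical
package (§3) and the final composition (§9) are typed CONCRETELY in the tree's vocabulary.

* Step 1 = `ClassicalPackage ν` (§3 as used on p. 43: Thm 3.4 short-time existence + Thm 3.5
  propagation of smoothness + Thm 3.1 energy inequality + Thm 3.6 blow-up criterion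
  `limsup_{t→T⁻} ‖u(t)‖_∞ = ∞`): every Clay datum either has a Clay-sense global solution or has a
  finite maximal time `T*` with a Condition-(S) solution on every `[0,T]`, `T < T*`, whose sup-norm is
  unbounded on `[0,T*)`. Classical, "proofs omitted" in the paper (p. 11 l. 500–502).
* Step 2 = `Theorem51 ν 𝒮` (Thm 5.1 "uniform bound", p. 17, TeX l. 803–827): IF `𝒮_B(u) ≤ 𝓑` on `[0,T′]`
  THEN `𝒮_B(u)(t) ≤ 𝓒 𝒮_B(u₀) + 𝓒 − 1` with `𝓒 = exp(C(1+ν⁻²)((1+‖u₀‖₂⁵)T + ν⁻¹‖u₀‖₂^{8/3}))`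
  INDEPENDENT of `𝓑` (the hypothesis (5.3) is used only to differentiate the series, Lemmas 4.2/4.6).
  Printed proof Steps 1–6 (pp. 17–25): Step 1 energy-type identity (5.6) for `|D^σP_ju|^{k−2}D^σP_ju`;
  Steps 2–3 (l. 904–1089, pp. 19–22) estimate the trilinear terms `I₁, I₂, I₃` and `‖D^σP_j(u⊗u)‖_k`,
  arriving at (5.17)/(5.18): a differential inequality LINEAR in the series with the energy-level
  coefficient `c₀(t) = 1 + ‖u(t)‖₂⁵ + ‖u(t)‖₄^{8/3}`; Steps 4–6 (pp. 22–25) sum over `j`, divide by `2^{B_k}`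
  (absorbing level `k` into level `5k` via `2^{B_{5k}/5}/2^{B_k} = 2^{(1/√5−1)√k} ≤ C/k⁶`), sum over `k`,
  Young, Gronwall with `∫₀^T c₀ ≤ (1+‖u₀‖₂⁵)T + Cν⁻¹‖u₀‖₂^{8/3}` (Cor. 3.2) — consistent bookkeeping GIVEN
  (5.18).
* Step 3 = `Theorem61 ν 𝒮low` (Thm 6.1, p. 25): the low-frequency series (6.1) with
  `B̂_k = (B − 1/√k)k + 2^B`, `J₀ = [8B/σ]` is `≤ 1` on `[0,T]` for `B ≥ B̃₁(ν,T,u₀)` (Lemmas 6.2, 6.3).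
* Step 4 = `Theorem71 ν 𝒮` (Thm 7.1 / Cor. 7.2, pp. 34–38): regularity improving from a bound on the
  `k₀`-level series.
* Step 5 = `Theorem81 ν 𝒮` (Thm 8.1 "new a priori estimate", p. 39): for Condition-(S) solutions on
  `[0,T]` and `B ≥ B̃(T,ν,u₀)`: `𝒮_B(u)(t) ≤ 2𝓒 − 1` on `[0,T]` — §8's continuity argument from Steps 2–4.
* Step 6 = `Corollary82 ν` (Cor. 8.2, p. 42 — THE LOAD-BEARING A PRIORI ESTIMATE, concrete):
  `‖u(t)‖_∞ ≤ B̌(T,ν,u₀)` on `[0,T]` for EVERY pair `(u,p)` satisfying Condition (S) on `[0,T]`;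
  `Corollary82Mono ν` is the form p. 43 uses (one `B̌` for all sub-horizons `T′ ≤ T`; the explicit
  `B̌ = C‖u₀‖₂ + C 2^{B̃+1}` of p. 42 with `B̃` nondecreasing in `T` supplies it).
* Step 7 = composition (§9, p. 43): Step 1 ∧ Step 6 (mono form) ⇒ Theorem 1.1 — PROVED here
  (`claim_of_steps`, pure logic: the blow-up alternative contradicts the sup-norm bound).
* v2 (referee ns-claims-ref-3's request): the weights `Bk` (5.2), `Bhat` (6.2) and the SCALAR displays
  Step 3b `WeightRatioDisplay` (Lemma 6.3 Step 4, p. 31 — the referee's first false display in dependency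
  order), Step 3c `WeightRatioBound` (its use, p. 31–32), Step 5b `WeightComparison85` (§8 Step 5 p. 41,
  PROVED as printed: `weightComparison85_holds`).
* HEADLINE = `ClaimedTheorem` := Theorem 1.1 (p. 1–2) at every `ν > 0` = Clay (A) VERBATIM
  (`claimedTheorem_iff : ClaimedTheorem ↔ clayR3.Regularity`, no delta); Theorem 1.2 (= Clay (B)) is
  stated with "can be proved similarly" (Remark 1.3(ii), p. 2) and has no proof text — not typed.
* Typist's flags for the refuter/referee (not a verdict): the candidate locus is INSIDE the proof of
  Thm 5.1, Steps 2–3 (l. 904–1089, pp. 19–22): a linear-in-`𝒮` differential inequality (5.18) with a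
  coefficient controlled by the energy class alone is a supercritical-to-subcritical upgrade (scaling
  audit `stDilation`; the estimates used — Bernstein, paraproducts, Calderón–Zygmund for `p` (Lemma 3.8),
  interpolation Lemma 4.1 — are all of the kind the averaged equation shares, so
  `Tao2016.averagedNS_blowup_holds` tests the chain Step 2 → Step 6). Cor. 8.2 is applied on p. 43 to a
  solution living on `[0,T)` with the constant of the closed horizon `T` (glue recorded as
  `Corollary82Mono`).
-/

noncomputable section

open Set Function MeasureTheory Filter
open scoped Topology ENNReal ContDiff

namespace Literature.Claims.NS.Li2013

open Literature.Analysis.FluidPDE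

/-! ### Vocabulary -/

/-- **Condition (S)** (p. 17, TeX l. 792–799) for the horizon `T` and the datum `u₀`: "(i) `u` and `p ∈
C¹([0,T], W^{m,2}(ℝ³) ∩ W^{m,∞}(ℝ³))` for any integer `m ≥ 1`; (ii) `u` and `p` satisfy (1.1) with `f ≡ 0`
and `u(x,0) = u₀(x)`" — typed as: a classical solution on `[0,T]` (tree `IsClassicalNSSolutionOn`:
jointly smooth, momentum equation, `div u = 0`) with `u 0 = u₀`, every spatial derivative of every slice
square-integrable and bounded (the `W^{m,2} ∩ W^{m,∞}` clause; the `C¹`-in-time bookkeeping is carried by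
joint smoothness). [cite: Li2013, §5 Condition (S) p.17] -/
def CondS (ν T : ℝ) (u₀ : EuclideanSpace ℝ (Fin 3) → EuclideanSpace ℝ (Fin 3))
    (u : ℝ → EuclideanSpace ℝ (Fin 3) → EuclideanSpace ℝ (Fin 3))
    (p : ℝ → EuclideanSpace ℝ (Fin 3) → ℝ) : Prop :=
  IsClassicalNSSolutionOn (Icc 0 T) ν 0 u p ∧ u 0 = u₀ ∧
    ∀ t ∈ Icc 0 T, ∀ n : ℕ,
      MemLp (iteratedFDeriv ℝ n (u t)) 2 volume ∧ MemLp (iteratedFDeriv ℝ n (u t)) ⊤ volume ∧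
      MemLp (iteratedFDeriv ℝ n (p t)) 2 volume ∧ MemLp (iteratedFDeriv ℝ n (p t)) ⊤ volume

/-- A Clay datum (Thm 1.1's hypothesis, p. 1: "smooth, divergence-free vector field in `ℝ³` satisfying
(1.2) `|∂^α u₀(x)| ≤ C_{αK}(1+|x|)^{−K}`" = Clay (4)). [cite: Li2013, Thm 1.1 p.1] -/
def IsDatum (u₀ : EuclideanSpace ℝ (Fin 3) → EuclideanSpace ℝ (Fin 3)) : Prop :=
  ContDiff ℝ ∞ u₀ ∧ NSWave0.IsDivFree u₀ ∧ HasRapidSpatialDecay u₀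

/-- The constant `𝓒` of (5.5), p. 17: `exp(C(1+ν⁻²)((1+‖u₀‖₂⁵)T + ν⁻¹‖u₀‖₂^{8/3}))`, `C` universal.
[cite: Li2013, Thm 5.1 (5.5) p.17] -/
def calC (C ν T : ℝ) (u₀ : EuclideanSpace ℝ (Fin 3) → EuclideanSpace ℝ (Fin 3)) : ℝ≥0∞ :=
  ENNReal.ofReal (Real.exp (C * (1 + ν⁻¹ ^ 2) *
    ((1 + (eLpNorm u₀ 2 volume).toReal ^ (5 : ℕ)) * T +
      ν⁻¹ * (eLpNorm u₀ 2 volume).toReal ^ ((8 : ℝ) / 3))))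

/-! ### Step 1 — the classical package (§3) as used on p. 43 -/

/-- **Step 1 — §3 (Thms 3.1, 3.4, 3.5, 3.6; "we … omit the proofs here", p. 11) in the form §9 p. 43
consumes them**: for every Clay datum, EITHER there is a global smooth solution with `f ≡ 0` and bounded
energy (1.3) (the case `T = +∞` of p. 43), OR there is a finite maximal time `T* > 0` and a pair `(u,p)`
satisfying Condition (S) on every `[0,T]`, `T < T*`, with `‖u(t)‖_∞` unbounded on `[0,T*)` (Thm 3.6,
"`limsup_{t→T⁻} ‖u(t)‖_∞ = ∞`"). Classical. [cite: Li2013, §3 p.11–12 and §9 p.43] -/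
def ClassicalPackage (ν : ℝ) : Prop :=
  ∀ u₀, IsDatum u₀ →
    ClayVariants.clayR3.Solvable ν 0 u₀ ∨
      ∃ Tstar : ℝ, 0 < Tstar ∧
        ∃ (u : ℝ → EuclideanSpace ℝ (Fin 3) → EuclideanSpace ℝ (Fin 3))
          (p : ℝ → EuclideanSpace ℝ (Fin 3) → ℝ),
          (∀ T, 0 < T → T < Tstar → CondS ν T u₀ u p) ∧
            ∀ M : ℝ, ∃ t ∈ Ico 0 Tstar, ∃ x, M < ‖u t x‖

/-! ### Steps 2–5 — the series tower (§§5–8), over an abstract series functional `𝒮` -/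

/-- **Step 2 — Theorem 5.1 "uniform bound" (p. 17, l. 803–827)**, over the abstract series functional
`𝒮 B u t` = (5.1): "Suppose `u` and `p` satisfy Condition (S). If `𝒮_B(u)(t) ≤ 𝓑` for any `0 ≤ t ≤ T′`,
where `𝓑` is a constant, then `𝒮_B(u)(t) ≤ 𝓒 𝒮_B(u₀) + 𝓒 − 1` … for any `0 ≤ t ≤ T′`, where `C > 0`
[in `𝓒`, (5.5)] is a universal constant" — the conclusion does not depend on `𝓑`.
[claim: Li2013, status: disputed] -/
def Theorem51 (ν : ℝ)
    (𝒮 : ℝ → (ℝ → EuclideanSpace ℝ (Fin 3) → EuclideanSpace ℝ (Fin 3)) → ℝ → ℝ≥0∞) : Prop :=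
  ∃ C : ℝ, 0 < C ∧ ∀ (T T' B : ℝ) (u₀ : EuclideanSpace ℝ (Fin 3) → EuclideanSpace ℝ (Fin 3)) u p,
    0 < T' → T' ≤ T → 0 < B → IsDatum u₀ → CondS ν T u₀ u p →
    ∀ 𝓑 : ℝ≥0∞, 𝓑 < ⊤ → (∀ t ∈ Icc 0 T', 𝒮 B u t ≤ 𝓑) →
      ∀ t ∈ Icc 0 T', 𝒮 B u t ≤ calC C ν T u₀ * 𝒮 B (fun _ => u₀) 0 + (calC C ν T u₀ - 1)

/-- **Step 3 — Theorem 6.1 (p. 25, l. 1257–1270)**, over the abstract LOW-FREQUENCY series functional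
`𝒮low B u t` = (6.1) (`B̂_k = (B − 1/√k)k + 2^B` (6.2), `j ≤ J₀ = [8B/σ]` (6.3)): "there exists `B̃₁`
depending only on `ν, T` and `u₀` such that if `B ≥ B̃₁` then (6.1) `≤ 1` for `0 ≤ t ≤ T`". FLAG
(referee ns-claims-ref-3, RETYPE §0): this statement is SUMMIT-STRENGTH — (6.4) with `k → ∞` bounds
`‖D²P_ju(t)‖_∞ ≤ 2^B` for `j ≤ 4B`, whence `sup_{[0,T]} ‖∇u‖_∞ ≤ C(‖u₀‖₂ + 2^{B̃₁(ν,T,u₀)})` for every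
Condition-(S) solution, i.e. regularity itself; it is proved through Lemma 6.2 (p. 25) and Lemma 6.3
(p. 28), whose Step 4 display (p. 31) is `WeightRatioDisplay` below. [claim: Li2013, status: disputed] -/
def Theorem61 (ν : ℝ)
    (𝒮low : ℝ → (ℝ → EuclideanSpace ℝ (Fin 3) → EuclideanSpace ℝ (Fin 3)) → ℝ → ℝ≥0∞) : Prop :=
  ∀ (T : ℝ) (u₀ : EuclideanSpace ℝ (Fin 3) → EuclideanSpace ℝ (Fin 3)), 0 < T → IsDatum u₀ →
    ∃ B₁ : ℝ, ∀ B, B₁ ≤ B → ∀ u p, CondS ν T u₀ u p → ∀ t ∈ Icc 0 T, 𝒮low B u t ≤ 1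

/-- **Step 4 — Theorem 7.1 / Corollary 7.2 "regularity improving" (pp. 34–38, l. 1733–1972)**, schematic
over `𝒮` and the `k₀`-level functional `𝒮₀ B u t = Σ_j ‖D^σP_ju(t)‖_{k₀}^{k₀}`: "IF `𝒮₀ ≤ 𝓑 2^{B_{k₀}}` on
`[0,T′]` and `B ≥ B̃₂(u₀,σ)` THEN the `D^{σ+1}`-level bound (7.2)" — typed as the existence of a bound for
the improved functional `𝒮⁺`. [claim: Li2013, status: disputed] -/
def Theorem71 (ν : ℝ)
    (𝒮₀ 𝒮plus : ℝ → (ℝ → EuclideanSpace ℝ (Fin 3) → EuclideanSpace ℝ (Fin 3)) → ℝ → ℝ≥0∞) : Prop :=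
  ∀ (T T' : ℝ) (u₀ : EuclideanSpace ℝ (Fin 3) → EuclideanSpace ℝ (Fin 3)), 0 < T' → T' ≤ T → IsDatum u₀ →
    ∃ B₂ : ℝ, ∀ B, B₂ ≤ B → ∀ u p, CondS ν T u₀ u p → ∀ 𝓑 : ℝ≥0∞, 𝓑 < ⊤ →
      (∀ t ∈ Icc 0 T', 𝒮₀ B u t ≤ 𝓑) → ∃ 𝓑' : ℝ≥0∞, 𝓑' < ⊤ ∧ ∀ t ∈ Icc 0 T', 𝒮plus B u t ≤ 𝓑'

/-- **Step 5 — Theorem 8.1 "new a priori estimate" (p. 39, l. 2022–2034)**: "Suppose `u` and `p` satisfy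
Condition (S). Then there exists `B̃ > 0` depending only on `T, ν` and `u₀` such that if `B ≥ B̃`, then
`𝒮_B(u)(t) ≤ 2𝓒 − 1` for any `0 ≤ t ≤ T`" (§8: continuity argument from Thms 5.1, 6.1, 7.1).
[claim: Li2013, status: disputed] -/
def Theorem81 (ν : ℝ)
    (𝒮 : ℝ → (ℝ → EuclideanSpace ℝ (Fin 3) → EuclideanSpace ℝ (Fin 3)) → ℝ → ℝ≥0∞) : Prop :=
  ∃ C : ℝ, 0 < C ∧ ∀ (T : ℝ) (u₀ : EuclideanSpace ℝ (Fin 3) → EuclideanSpace ℝ (Fin 3)),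
    0 < T → IsDatum u₀ → ∃ Btilde : ℝ, 0 < Btilde ∧ ∀ B, Btilde ≤ B → ∀ u p, CondS ν T u₀ u p →
      ∀ t ∈ Icc 0 T, 𝒮 B u t ≤ 2 * calC C ν T u₀ - 1

/-! ### Step 6 — Corollary 8.2 (p. 42), the load-bearing a priori estimate, CONCRETE -/

/-- **Step 6 — Corollary 8.2 (p. 42, l. 2205–2211) AS PRINTED**: "Let `T > 0` and `u₀` be a function
satisfying (1.2). There exists `B̌ > 0` depending only on `T, ν` and `u₀` such that if `u` and `p` satisfy
Condition (S), then `‖u(t)‖_∞ ≤ B̌` for any `0 ≤ t ≤ T`." A horizon-uniform `L^∞` a priori bound for ALL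
smooth decaying solutions from `u₀` on `[0,T]`. [claim: Li2013, status: disputed] -/
def Corollary82 (ν : ℝ) : Prop :=
  ∀ (T : ℝ) (u₀ : EuclideanSpace ℝ (Fin 3) → EuclideanSpace ℝ (Fin 3)), 0 < T → IsDatum u₀ →
    ∃ B : ℝ, ∀ u p, CondS ν T u₀ u p → ∀ t ∈ Icc 0 T, ∀ x, ‖u t x‖ ≤ B

/-- **Step 6, the form §9 p. 43 uses** ("Let `B̌` be given by Corollary 8.2 with `u₀`, `ν` and this `T`.
Then … `‖u(t)‖_∞ < B̌` for any `0 ≤ t < T`", applied to a solution living on `[0,T)`): ONE constant for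
all sub-horizons `T′ ≤ T`. (Supplied by the printed `B̌ = C‖u₀‖₂ + C2^{B̃+1}`, p. 42, once `B̃(T,ν,u₀)` is
nondecreasing in `T`; recorded as the glue it is.) [claim: Li2013, status: disputed] -/
def Corollary82Mono (ν : ℝ) : Prop :=
  ∀ (T : ℝ) (u₀ : EuclideanSpace ℝ (Fin 3) → EuclideanSpace ℝ (Fin 3)), 0 < T → IsDatum u₀ →
    ∃ B : ℝ, ∀ T', 0 < T' → T' ≤ T → ∀ u p, CondS ν T' u₀ u p → ∀ t ∈ Icc 0 T', ∀ x, ‖u t x‖ ≤ B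

/-- The mono form gives the printed form (`T′ = T`). [cite: Li2013, Cor. 8.2 p.42] -/
theorem corollary82_of_mono {ν : ℝ} (h : Corollary82Mono ν) : Corollary82 ν := by
  intro T u₀ hT hu₀
  obtain ⟨B, hB⟩ := h T u₀ hT hu₀
  exact ⟨B, fun u p hS t ht x => hB T hT le_rfl u p hS t ht x⟩

/-! ### Headline and composition (§9, p. 43) -/

/-- **HEADLINE — Theorem 1.1 (p. 1–2) at every viscosity** ("`ν` is a positive constant", p. 1): "Let `u₀`
be any smooth, divergence-free vector field in `ℝ³` satisfying (1.2). Then there exist smooth functions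
`p(x,t)` and `u(x,t)` on `ℝ³ × [0,∞)` that satisfy (1.1) with `u(x,0) = u₀(x)`, `f ≡ 0` and
`∫|u(x,t)|²dx < C` for all `t ≥ 0` (1.3)." [claim: Li2013, status: disputed] -/
def ClaimedTheorem : Prop :=
  ∀ ν : ℝ, 0 < ν → ∀ u₀ : EuclideanSpace ℝ (Fin 3) → EuclideanSpace ℝ (Fin 3),
    ContDiff ℝ ∞ u₀ → NSWave0.IsDivFree u₀ → HasRapidSpatialDecay u₀ →
      ∃ (u : ℝ → EuclideanSpace ℝ (Fin 3) → EuclideanSpace ℝ (Fin 3))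
        (p : ℝ → EuclideanSpace ℝ (Fin 3) → ℝ),
        IsSmoothOnHalfSpace u ∧ IsSmoothOnHalfSpace p ∧ IsNavierStokesSolution ν 0 u₀ u p ∧
          HasBoundedEnergy u

/-- **No Clay delta**: Theorem 1.1 (all `ν > 0`) IS Clay (A) in the tree's `ClaySpec` vocabulary.
[cite: Li2013, Thm 1.1 p.1–2] -/
theorem claimedTheorem_iff : ClaimedTheorem ↔ ClayVariants.clayR3.Regularity := Iff.rfl

/-- `clay_of_claimed` (trivial: the headline is (A)). [cite: Li2013, Thm 1.1 p.1–2] -/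
theorem clay_of_claimed (h : ClaimedTheorem) : ClayVariants.clayR3.Regularity := h

/-- **Step 7 — the composition of §9 (p. 43) is pure logic**: the classical package (Step 1) and the
sup-norm a priori bound in the form p. 43 uses (Step 6, `Corollary82Mono`) give Theorem 1.1 at `ν`:
in the blow-up branch, `‖u(t)‖_∞` is unbounded on `[0,T*)` yet bounded by `B̌(T*,ν,u₀)` there.
[claim: Li2013, status: disputed] -/
theorem regularityAt_of_steps {ν : ℝ} (h1 : ClassicalPackage ν) (h6 : Corollary82Mono ν) :
    ClayVariants.clayR3.RegularityAt ν := by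
  intro u₀ hu₀ hdiv hdata
  rcases h1 u₀ ⟨hu₀, hdiv, hdata⟩ with hsol | ⟨Tstar, hTstar, u, p, hS, hunb⟩
  · exact hsol
  · exfalso
    obtain ⟨B, hB⟩ := h6 Tstar u₀ hTstar ⟨hu₀, hdiv, hdata⟩
    obtain ⟨t, ⟨ht0, htT⟩, x, hx⟩ := hunb B
    -- apply the bound on the closed sub-horizon `[0, T']`, `T' = (t + T*)/2 < T*`
    have hT'pos : 0 < (t + Tstar) / 2 := by linarith
    have hT'lt : (t + Tstar) / 2 < Tstar := by linarith
    have hle := hB ((t + Tstar) / 2) hT'pos hT'lt.le u p (hS _ hT'pos hT'lt) t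
      ⟨ht0, by linarith⟩ x
    exact absurd hle (not_le.mpr hx)

/-- Steps 1 and 6 at every `ν > 0` give the headline. [claim: Li2013, status: disputed] -/
theorem claim_of_steps (h1 : ∀ ν : ℝ, 0 < ν → ClassicalPackage ν)
    (h6 : ∀ ν : ℝ, 0 < ν → Corollary82Mono ν) : ClaimedTheorem :=
  fun ν hν => regularityAt_of_steps (h1 ν hν) (h6 ν hν)

/-! ### v2 (append, referee ns-claims-ref-3's typing note 19:33Z): the weights (5.2)/(6.2) and the scalar
displays of Lemma 6.3 Step 4 (p. 31) and §8 Step 5 (p. 41) at the abstract-real grain (F15) -/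

/-- The weight exponent (5.2), p. 17: `B_k = (B + 1 + 1/√k) k`. [cite: Li2013, (5.2) p.17] -/
def Bk (B : ℝ) (k : ℕ) : ℝ :=
  (B + 1 + 1 / Real.sqrt k) * k

/-- The weight exponent (6.2), p. 25: `B̂_k = (B − 1/√k) k + 2^B` (additive `2^B`, as printed).
[cite: Li2013, (6.2) p.25] -/
def Bhat (B : ℝ) (k : ℕ) : ℝ :=
  (B - 1 / Real.sqrt k) * k + (2 : ℝ) ^ B

/-- The interpolation exponent of Lemma 6.3 Steps 3–4 (p. 30–31): `θ = (1 − 2/k)(1 − λ)/(1 − ((k−2)/k)λ)`,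
with `λ ∈ [2/5, 3/5]` from (6.13). [cite: Li2013, Lemma 6.3 Step 3 (6.13) p.30] -/
def thetaExp (k : ℕ) (lam : ℝ) : ℝ :=
  (1 - 2 / (k : ℝ)) * (1 - lam) / (1 - ((k : ℝ) - 2) / k * lam)

/-- **Step 3b — Lemma 6.3, Step 4, the display p. 31 (TeX l. 1603–1610) AS PRINTED**: "In view of (6.2),
(6.13) and `k ≥ 2k₀ = 200`,
`(2^{B̂_{[(k+1)/2]}·k/[(k+1)/2]} / 2^{B̂_k})^θ = (2^{k(1/√k − 1/√[(k+1)/2])})^θ`" with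
`θ = (1 − 2/k)(1 − λ)/(1 − ((k−2)/k)λ)`, `λ ∈ [2/5, 3/5]`, `B > 1` (Thm 6.1's standing hypothesis), and
`[(k+1)/2]` the integer part. (Referee's pre-read: with (6.2) as printed the exponent on the left is
`k(1/√k − 1/√m) + 2^B(k/m − 1)`, `m = [(k+1)/2]`; the display drops `2^B(k/m − 1)`.)
[claim: Li2013, status: disputed] -/
def WeightRatioDisplay : Prop :=
  ∀ (B : ℝ) (k : ℕ) (lam : ℝ), 1 < B → 200 ≤ k → 2 / 5 ≤ lam → lam ≤ 3 / 5 →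
    ((2 : ℝ) ^ (Bhat B ((k + 1) / 2) * ((k : ℝ) / (((k + 1) / 2 : ℕ) : ℝ))) / (2 : ℝ) ^ Bhat B k) ^
        thetaExp k lam =
      ((2 : ℝ) ^ ((k : ℝ) * (1 / Real.sqrt k - 1 / Real.sqrt (((k + 1) / 2 : ℕ) : ℝ)))) ^ thetaExp k lam

/-- **Step 3c — the bound the display is used for (p. 31, same display, last two inequalities)**:
"`… ≤ 2^{(3/5)k(1/√k − 1/√((2/3)k))} = 2^{(3/5)√k(1 − √(3/2))} ≤ C k^{−10} 2^{−√k/10}`, where `C` is universal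
constant" — i.e. ONE constant `C`, independent of `B`, bounds the weight ratio for all `B > 1`, `k ≥ 200`,
`λ ∈ [2/5, 3/5]`; this is what enters (6.15)/(6.10) (p. 32). [claim: Li2013, status: disputed] -/
def WeightRatioBound : Prop :=
  ∃ C : ℝ, ∀ (B : ℝ) (k : ℕ) (lam : ℝ), 1 < B → 200 ≤ k → 2 / 5 ≤ lam → lam ≤ 3 / 5 →
    ((2 : ℝ) ^ (Bhat B ((k + 1) / 2) * ((k : ℝ) / (((k + 1) / 2 : ℕ) : ℝ))) / (2 : ℝ) ^ Bhat B k) ^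
        thetaExp k lam ≤
      C * (k : ℝ) ^ (-(10 : ℝ)) * (2 : ℝ) ^ (-(Real.sqrt k / 10))

/-- **Step 5b — §8 Step 5, p. 41 (TeX l. 2160–2164), the consumer of Theorem 6.1**: "From (5.2) and (6.2),
we have `lim_{k→∞} B̂_k/B_k = B/(B+1)`. Therefore there exists `k̂ ≥ k₀` such that `B̂_k ≤ B_k`" [for
`k ≥ k̂`] — the comparison that turns (8.7) into finiteness of the low-frequency part of (5.3). TRUE as
printed (`weightComparison85_holds`); recorded because the charitable re-reading of (6.2) that repairs
`WeightRatioDisplay` (`2^B·k` in place of `2^B`, referee's R#a) breaks exactly here.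
[cite: Li2013, §8 Step 5 p.41] -/
def WeightComparison85 : Prop :=
  ∀ B : ℝ, 1 < B → ∃ khat : ℕ, 100 ≤ khat ∧ ∀ k : ℕ, khat ≤ k → Bhat B k ≤ Bk B k

/-- Step 5b holds as printed: `B_k − B̂_k = k + 2√k − 2^B ≥ 0` for `k ≥ 2^B`. [cite: Li2013, §8 Step 5 p.41] -/
theorem weightComparison85_holds : WeightComparison85 := by
  intro B _hB
  refine ⟨max 100 ⌈(2 : ℝ) ^ B⌉₊, le_max_left _ _, fun k hk => ?_⟩
  have hk2 : (2 : ℝ) ^ B ≤ k :=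
    (Nat.le_ceil _).trans (by exact_mod_cast (le_max_right _ _).trans hk)
  have hs : 0 ≤ 1 / Real.sqrt k * k := by positivity
  unfold Bhat Bk
  nlinarith [hs, hk2]

/-! ### v3 (append, refuter-8's ask 19:50Z): the same p. 31 display at the grain of EXPONENTS -/

/-- **Step 3b′ — Lemma 6.3 Step 4, p. 31, the exponent identity the display asserts** ("In view of (6.2)
…": `2^{B̂_m·k/m}/2^{B̂_k} = 2^{k(1/√k − 1/√m)}`, `m = [(k+1)/2]`, i.e. `B̂_m·k/m − B̂_k = k(1/√k − 1/√m)`),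
typed with (6.2) as printed; the `θ`-power of `WeightRatioDisplay` is this identity raised to `θ > 0`.
[claim: Li2013, status: disputed] -/
def WeightRatioExponent : Prop :=
  ∀ (B : ℝ) (k : ℕ), 1 < B → 200 ≤ k →
    Bhat B ((k + 1) / 2) * ((k : ℝ) / (((k + 1) / 2 : ℕ) : ℝ)) - Bhat B k =
      (k : ℝ) * (1 / Real.sqrt k - 1 / Real.sqrt (((k + 1) / 2 : ℕ) : ℝ))

/-- The display follows from the exponent identity (so a refutation of the display refutes the identity
the print invokes; the converse direction is the refuter's). [cite: Li2013, Lemma 6.3 Step 4 p.31] -/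
theorem weightRatioDisplay_of_exponent (h : WeightRatioExponent) : WeightRatioDisplay := by
  intro B k lam hB hk _h1 _h2
  have hexp := h B k hB hk
  rw [← Real.rpow_sub (by norm_num : (0 : ℝ) < 2), hexp]

end Literature.Claims.NS.Li2013

end
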